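import Summits.KontsevichZagierPeriods.KontsevichZagierPeriods.Theorems.HurwitzMicroSectorsNormalFormPrincipleM4LevelOneFromLevelTwo
import Summits.KontsevichZagierPeriods.KontsevichZagierPeriods.Theorems.HurwitzMicroSectorsNormalFormPrincipleM4EtaFourDistribution

/-!
# `NormalFormPrinciple` (stmt-KontsevichZagierPeriods-3869), line `SketchIdeator1` —
# leaf `stub_boxRigidity`, layer `M4` kernel: the five `ζ(4)`-valued reductions

Registered sub-goal `m4k4_reduce_zeta` of the dimension-four kernel theorem (lead seat c9,
`--supports` the crux). With the reference `Z4 = [□⁴, 1/(1 − x₀x₁x₂x₃)]` (value `ζ(4)`) and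
`Π = x₀x₁x₂x₃`, each of the five rational box families `N = [□⁴, fᵢ]` of the census reduces,
after multiplication by `8`, to an integer multiple of `Z4` modulo `KZ.relations`
(`8[N] ≡ αᵢ[Z4] + 0·[C1 × Z3]`, the second reference carrying the coefficient zero):

* `f₁ = 1/(1 − Π)`,                 `α₁ = 8`   (congruence of representations);
* `f₂ = 1/(1 + Π)`,                 `α₂ = 7`   (`8η(4) = 7ζ(4)`, `m4_etaFour_distribution`);
* `f₃ = 1/((1 − x₀x₁)(1 − Π))`,     `α₃ = 14`  (`4(ζ(4) + ζ(2,2)) = 7ζ(4)`, `m4_zetaTwoTwo_box`);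
* `f₄ = 1/((1 − x₀x₁x₂)(1 − Π))`,   `α₄ = 10`  (`4(ζ(4) + ζ(3,1)) = 5ζ(4)`, `m4_zetaThreeOne_box`);
* `f₅ = 1/((1 − x₀x₁)(1 − x₂x₃))`,  `α₅ = 20`  (`2ζ(2)² = 5ζ(4)`, `m4_zetaTwoSquared_box`).

Each landed box pair `a·[□⁴, f] ∼ b·[□⁴, g]` is stated for representations CONGRUENT to the scaled
integrands; it is applied to the scaled representations `N.constMul a`, `Z4.constMul b`
(`KZ.IntegralRep.constMul`) and unscaled by the rule-(1b) congruence
`KZ.IntegralRep.of_constMul_nat_sub_nsmul_mem_relations` (`[r.constMul k] − k•[r] ∈ KZ.relations`);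
the remaining bookkeeping is integer linear algebra in the free abelian group `KZ.FormalRep`.
Moves used (inside the cited box pairs): the cubical chart onto words of `Δ₄` (rule (2)), partial
fractions as integrand additivity (rule (1b)), the weight-four words-level relations through level
two, and the product ideal. References: M. Kontsevich, D. Zagier, *Periods* (2001), §1.1, §1.2
rules (1), (2); §4.1. No definitions are introduced.
-/

noncomputable section

open MeasureTheory Set
open Literature.NumberTheory.Transcendental Literature.NumberTheory.Transcendental.KZ
open Literature.ModelTheory.ExponentialFields (IsSemialgebraic)
open Summit.KontsevichZagierPeriods.HyperbolicBloch.OffTetraSectorKernel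
  (aff_orbit_of_sub_sum_zsmul_mem_relations)
open Summit.KontsevichZagierPeriods.HurwitzMicroSectors.NormalFormPrinciple.PiBox.Dilog
  (exists_dilogBox bss_box_sub_simplex_of_one_le)

namespace Summit.KontsevichZagierPeriods.HurwitzMicroSectors.NormalFormPrinciple.PiBox.M3

/-- **Integrand of a scaled representation, up to congruence.** If `r ≡ f` on its domain and
`k·f = g` pointwise, then `r.constMul k ≡ g` on its (unchanged) domain.
[cite: KontsevichZagier2001, §1.1] -/
theorem m4ka_eqOn_constMul {n : ℕ} (r : IntegralRep n) (k : ℕ) {f : (Fin n → ℝ) → ℝ}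
    (g : (Fin n → ℝ) → ℝ) (h : EqOn r.integrand f r.domain) (hfg : ∀ x, (k:ℝ) * f x = g x) :
    EqOn (r.constMul (k:ℝ) (isAlgebraic_nat k)).integrand g
      (r.constMul (k:ℝ) (isAlgebraic_nat k)).domain := fun x hx => by
  rw [IntegralRep.integrand_constMul, ← hfg x, ← h hx]

/-- **Domain of a scaled representation.** [cite: KontsevichZagier2001, §1.1] -/
theorem m4ka_domain_constMul {n : ℕ} (r : IntegralRep n) (k : ℕ) {D : Set (Fin n → ℝ)}
    (h : r.domain = D) : (r.constMul (k:ℝ) (isAlgebraic_nat k)).domain = D := by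
  rw [IntegralRep.domain_constMul, h]

/-- **Unscaling an equivalence of scaled representations.** From
`[r.constMul a] − [r'.constMul b] ∈ KZ.relations` to `a•[r] − b•[r'] ∈ KZ.relations`, by the
rule-(1b) congruences `[r.constMul k] − k•[r]` (`of_constMul_nat_sub_nsmul_mem_relations`).
[cite: KontsevichZagier2001, §1.2 rule (1)] -/
theorem m4ka_nsmul_sub_nsmul_mem {n : ℕ} (r r' : IntegralRep n) (a b : ℕ)
    (h : Equivalent (r.constMul (a:ℝ) (isAlgebraic_nat a)) (r'.constMul (b:ℝ) (isAlgebraic_nat b))) :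
    a • of r - b • of r' ∈ relations := by
  have ha := IntegralRep.of_constMul_nat_sub_nsmul_mem_relations r a
  have hb := IntegralRep.of_constMul_nat_sub_nsmul_mem_relations r' b
  have e : a • of r - b • of r' =
      (of (r.constMul (a:ℝ) (isAlgebraic_nat a)) - of (r'.constMul (b:ℝ) (isAlgebraic_nat b))) -
        (of (r.constMul (a:ℝ) (isAlgebraic_nat a)) - a • of r) +
        (of (r'.constMul (b:ℝ) (isAlgebraic_nat b)) - b • of r') := by
    abel
  rw [e]
  exact relations.add_mem (relations.sub_mem h ha) hb

/-- **The five `ζ(4)`-valued reductions of the dimension-four kernel** (lead seat c9, line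
`SketchIdeator1`, layer `M4` kernel). For the references `Z4 = [□⁴, 1/(1 − Π)]`,
`C1 = [(0,1), 1/(1 + x₀)]`, `Z3 = [□³, 1/(1 − x₀x₁x₂)]` and every box `N = [□⁴, ≡ fᵢ]`:
`8[N] − (αᵢ[Z4] + 0·[C1 × Z3]) ∈ KZ.relations` with
`(fᵢ, αᵢ) = (1/(1 − Π), 8), (1/(1 + Π), 7), (1/((1 − x₀x₁)(1 − Π)), 14),
(1/((1 − x₀x₁x₂)(1 − Π)), 10), (1/((1 − x₀x₁)(1 − x₂x₃)), 20)`, `Π = x₀x₁x₂x₃`.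
[cite: KontsevichZagier2001, §1.2 rules (1), (2); §4.1] -/
theorem m4k4_reduce_zeta :
    ∀ (Z4 : IntegralRep 4) (C1 : IntegralRep 1) (Z3 : IntegralRep 3),
      Z4.domain = {x | ∀ i, x i ∈ Set.Ioo (0:ℝ) 1} → (Z4.integrand = fun x => 1 / (1 - x 0 * x 1 * x 2 * x 3)) →
      C1.domain = {x | ∀ i, x i ∈ Set.Ioo (0:ℝ) 1} → (C1.integrand = fun x => 1 / (1 + x 0)) →
      Z3.domain = {x | ∀ i, x i ∈ Set.Ioo (0:ℝ) 1} → (Z3.integrand = fun x => 1 / (1 - x 0 * x 1 * x 2)) →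
        (∀ N : IntegralRep 4, N.domain = {x | ∀ i, x i ∈ Set.Ioo (0:ℝ) 1} →
          EqOn N.integrand (fun x => 1 / (1 - x 0 * x 1 * x 2 * x 3)) N.domain →
          (8:ℕ) • of N - ((8:ℤ) • of Z4 + (0:ℤ) • of (C1.prod Z3)) ∈ relations) ∧
        (∀ N : IntegralRep 4, N.domain = {x | ∀ i, x i ∈ Set.Ioo (0:ℝ) 1} →
          EqOn N.integrand (fun x => 1 / (1 + x 0 * x 1 * x 2 * x 3)) N.domain →
          (8:ℕ) • of N - ((7:ℤ) • of Z4 + (0:ℤ) • of (C1.prod Z3)) ∈ relations) ∧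
        (∀ N : IntegralRep 4, N.domain = {x | ∀ i, x i ∈ Set.Ioo (0:ℝ) 1} →
          EqOn N.integrand (fun x => 1 / ((1 - x 0 * x 1) * (1 - x 0 * x 1 * x 2 * x 3))) N.domain →
          (8:ℕ) • of N - ((14:ℤ) • of Z4 + (0:ℤ) • of (C1.prod Z3)) ∈ relations) ∧
        (∀ N : IntegralRep 4, N.domain = {x | ∀ i, x i ∈ Set.Ioo (0:ℝ) 1} →
          EqOn N.integrand (fun x => 1 / ((1 - x 0 * x 1 * x 2) * (1 - x 0 * x 1 * x 2 * x 3))) N.domain →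
          (8:ℕ) • of N - ((10:ℤ) • of Z4 + (0:ℤ) • of (C1.prod Z3)) ∈ relations) ∧
        (∀ N : IntegralRep 4, N.domain = {x | ∀ i, x i ∈ Set.Ioo (0:ℝ) 1} →
          EqOn N.integrand (fun x => 1 / ((1 - x 0 * x 1) * (1 - x 2 * x 3))) N.domain →
          (8:ℕ) • of N - ((20:ℤ) • of Z4 + (0:ℤ) • of (C1.prod Z3)) ∈ relations) := by
  intro Z4 C1 Z3 hZ4d hZ4i _ _ _ _
  have hZ4e : EqOn Z4.integrand (fun x => 1 / (1 - x 0 * x 1 * x 2 * x 3)) Z4.domain :=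
    fun x _ => by rw [hZ4i]
  refine ⟨fun N hNd hNi => ?_, fun N hNd hNi => ?_, fun N hNd hNi => ?_, fun N hNd hNi => ?_,
    fun N hNd hNi => ?_⟩
  · -- `f₁`: `N` and `Z4` are congruent representations
    have c : of N - of Z4 ∈ relations :=
      of_sub_of_mem_relations_of_eqOn (hZ4d.trans hNd.symm) fun x hx => by rw [hNi hx, hZ4i]
    have e : (8:ℕ) • of N - ((8:ℤ) • of Z4 + (0:ℤ) • of (C1.prod Z3)) = (8:ℕ) • (of N - of Z4) := by
      simp only [zero_smul, add_zero]
      abel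
    rw [e]
    exact relations.nsmul_mem c _
  · -- `f₂`: `8[N] − 7[Z4]` is the distribution instance `8η(4) = 7ζ(4)`
    have c : (8:ℕ) • of N - (7:ℕ) • of Z4 ∈ relations :=
      m4ka_nsmul_sub_nsmul_mem N Z4 8 7 (m4_etaFour_distribution _ _ (m4ka_domain_constMul N 8 hNd)
        (m4ka_eqOn_constMul N 8 _ hNi fun x => by push_cast; ring) (m4ka_domain_constMul Z4 7 hZ4d)
        (m4ka_eqOn_constMul Z4 7 _ hZ4e fun x => by push_cast; ring))
    have e : (8:ℕ) • of N - ((7:ℤ) • of Z4 + (0:ℤ) • of (C1.prod Z3)) =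
        (8:ℕ) • of N - (7:ℕ) • of Z4 := by
      simp only [zero_smul, add_zero]
      abel
    rw [e]
    exact c
  · -- `f₃`: `7[Z4] − 4[N]` is the box pair `ζ(2,2) + ζ(4) = (7/4)ζ(4)`
    have c : (7:ℕ) • of Z4 - (4:ℕ) • of N ∈ relations :=
      m4ka_nsmul_sub_nsmul_mem Z4 N 7 4 (m4_zetaTwoTwo_box _ _ (m4ka_domain_constMul Z4 7 hZ4d)
        (m4ka_eqOn_constMul Z4 7 _ hZ4e fun x => by push_cast; ring) (m4ka_domain_constMul N 4 hNd)
        (m4ka_eqOn_constMul N 4 _ hNi fun x => by push_cast; ring))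
    have e : (8:ℕ) • of N - ((14:ℤ) • of Z4 + (0:ℤ) • of (C1.prod Z3)) =
        -((2:ℕ) • ((7:ℕ) • of Z4 - (4:ℕ) • of N)) := by
      simp only [zero_smul, add_zero]
      abel
    rw [e]
    exact relations.neg_mem (relations.nsmul_mem c _)
  · -- `f₄`: `4[N] − 5[Z4]` is the box pair `ζ(3,1) + ζ(4) = (5/4)ζ(4)`
    have c : (4:ℕ) • of N - (5:ℕ) • of Z4 ∈ relations :=
      m4ka_nsmul_sub_nsmul_mem N Z4 4 5 (m4_zetaThreeOne_box _ _ (m4ka_domain_constMul N 4 hNd)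
        (m4ka_eqOn_constMul N 4 _ hNi fun x => by push_cast; ring) (m4ka_domain_constMul Z4 5 hZ4d)
        (m4ka_eqOn_constMul Z4 5 _ hZ4e fun x => by push_cast; ring))
    have e : (8:ℕ) • of N - ((10:ℤ) • of Z4 + (0:ℤ) • of (C1.prod Z3)) =
        (2:ℕ) • ((4:ℕ) • of N - (5:ℕ) • of Z4) := by
      simp only [zero_smul, add_zero]
      abel
    rw [e]
    exact relations.nsmul_mem c _
  · -- `f₅`: `2[N] − 5[Z4]` is the box pair `ζ(2)² = (5/2)ζ(4)`
    have c : (2:ℕ) • of N - (5:ℕ) • of Z4 ∈ relations :=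
      m4ka_nsmul_sub_nsmul_mem N Z4 2 5 (m4_zetaTwoSquared_box _ _ (m4ka_domain_constMul N 2 hNd)
        (m4ka_eqOn_constMul N 2 _ hNi fun x => by push_cast; ring) (m4ka_domain_constMul Z4 5 hZ4d)
        (m4ka_eqOn_constMul Z4 5 _ hZ4e fun x => by push_cast; ring))
    have e : (8:ℕ) • of N - ((20:ℤ) • of Z4 + (0:ℤ) • of (C1.prod Z3)) =
        (4:ℕ) • ((2:ℕ) • of N - (5:ℕ) • of Z4) := by
      simp only [zero_smul, add_zero]
      abel
    rw [e]
    exact relations.nsmul_mem c _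

end Summit.KontsevichZagierPeriods.HurwitzMicroSectors.NormalFormPrinciple.PiBox.M3
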